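import Summits.CriticalPhenomena.PercolationContinuityZ3.Theorems.PercNearOneGluingNoHeavyLowerTailSunflowerSafeCalculus
import Mathlib.Combinatorics.SimpleGraph.Basic
import HarnessLib
import HarnessLib.Audit

/-!
# `NoHeavyLowerTail` (crux stmt-CriticalPhenomena-4575), abstract sunflower cubic: GRAPH CORES — a triangle kills safety

Support file (seat `prim-ineq-prove-1` gen 39; `--supports stmt-CriticalPhenomena-4575`).  No `sorry`, no named facts.  Memo:
run/shared/lean/prim/prim-ineq-prove-1/FINDING-GRAPHCORES-prove1-g39.md.

SETTING.  `μ = prodBernoulli p` on `Set ι` (`ι` finite).  The **graph core** of a simple graph `Γ` on `ι` is the up-set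
`edgeCore Γ = {ω | some edge of Γ has both endpoints in ω}` (the core generated by the edges).  A core `A` is **A-safe**
when it is safe (`SafeCalc.Safe p A`: Lemma A in product form for every number of petals) for EVERY parameter
vector `p : ι → [0,1]`.
THEOREM `not_aSafe_of_triangle`: **if `Γ` contains a triangle then `edgeCore Γ` is not A-safe** (`∃ p, ¬ Safe p (edgeCore Γ)`).  Proof: put `p = 1/64` on the
three vertices `a, b, c` of the triangle and `p = 0` elsewhere; the three petals `{a ∈ ω}, {b ∈ ω}, {c ∈ ω}` meet pairwise inside
the core (each pair is an edge), have probability `1/64` each, while `μ(edgeCore Γ) ≤ 3/64² + 0` (union bound: an open edge inside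
the triangle, or an open vertex of probability `0`); and `(1/64)³ > (3/4096)²`.  (This is the `maj₃` obstruction `x₁x₂ ∨ x₁x₃ ∨ x₂x₃`
transported to an arbitrary graph through the deletion minor `p = 0`.)
CONTEXT (memo): the exact census of this line (gen 38 job j136812 + gen 39) shows the converse for all graphs on at most 8
vertices — a graph core is A-safe iff the graph is triangle-free (`K₂,₃`, `K₃,₃`, the pentagon, the Petersen-like cubic graphs on 8
vertices included); the typed conjecture is `TriangleFreeSafe` below.
-/

noncomputable section

namespace Summit.CriticalPhenomena.PercolationContinuityZ3.Theorems.SunflowerPartition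

namespace SafeCalc

open MeasureTheory Finset
open Literature.Probability.LatticeModels Literature.Probability.Percolation

variable {ι : Type*}

/-! ## Graph cores -/

/-- The **graph core** of `Γ`: some edge of `Γ` has both endpoints open. [this work] -/
def edgeCore (Γ : SimpleGraph ι) : Set (Set ι) := {ω | ∃ u v, Γ.Adj u v ∧ u ∈ ω ∧ v ∈ ω}

/-- The graph core is an up-set. [this work] -/
theorem isUpperSet_edgeCore (Γ : SimpleGraph ι) : IsUpperSet (edgeCore Γ) := by
  rintro ω ω' hle ⟨u, v, huv, hu, hv⟩
  exact ⟨u, v, huv, hle hu, hle hv⟩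

/-- The two-point cylinder `{u ∈ ω ∧ v ∈ ω}`. [this work] -/
def pairEv (u v : ι) : Set (Set ι) := {ω | u ∈ ω ∧ v ∈ ω}

/-- Probability of the two-point cylinder: `p u * p v` (`u ≠ v`). [this work] -/
theorem real_pairEv [DecidableEq ι] (p : ι → unitInterval) {u v : ι} (huv : u ≠ v) :
    (prodBernoulli p).real (pairEv u v) = (p u : ℝ) * p v := by
  have h : pairEv u v = {ω : Set ι | (↑({u, v} : Finset ι) : Set ι) ⊆ ω} := by
    ext ω
    simp only [pairEv, Set.mem_setOf_eq, Finset.coe_insert, Finset.coe_singleton, Set.insert_subset_iff,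
      Set.singleton_subset_iff]
  rw [h, prodBernoulli_real_subset, Finset.prod_pair huv]

/-- The parameter vector of the counterexample: `1/64` on `a, b, c`, `0` elsewhere. [this work] -/
def triParam [DecidableEq ι] (a b c : ι) : ι → unitInterval :=
  fun v => if v = a ∨ v = b ∨ v = c then ⟨1 / 64, by norm_num⟩ else 0

/-- **A graph with a triangle has a non-safe graph core.** [this work] -/
theorem not_aSafe_of_triangle [Fintype ι] [DecidableEq ι] (Γ : SimpleGraph ι) {a b c : ι}
    (hab : Γ.Adj a b) (hac : Γ.Adj a c) (hbc : Γ.Adj b c) : ∃ p : ι → unitInterval, ¬ Safe p (edgeCore Γ) := by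
  refine ⟨triParam a b c, fun hsafe => ?_⟩
  set p : ι → unitInterval := triParam a b c with hp
  have hpa : (p a : ℝ) = 1 / 64 := by simp [hp, triParam]
  have hpb : (p b : ℝ) = 1 / 64 := by simp [hp, triParam]
  have hpc : (p c : ℝ) = 1 / 64 := by simp [hp, triParam]
  have hp0 : ∀ v, ¬ (v = a ∨ v = b ∨ v = c) → (p v : ℝ) = 0 := by
    intro v hv
    simp [hp, triParam, hv]
  -- the three petals
  let V : Fin 3 → Set (Set ι) := ![{ω | a ∈ ω}, {ω | b ∈ ω}, {ω | c ∈ ω}]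
  have hV0 : V 0 = {ω | a ∈ ω} := rfl
  have hV1 : V 1 = {ω | b ∈ ω} := rfl
  have hV2 : V 2 = {ω | c ∈ ω} := rfl
  have hV : ∀ i, IsUpperSet (V i) := by
    intro i
    fin_cases i
    · exact fun ω ω' hle (hω : a ∈ ω) => hle hω
    · exact fun ω ω' hle (hω : b ∈ ω) => hle hω
    · exact fun ω ω' hle (hω : c ∈ ω) => hle hω
  have hcap : ∀ i j, i ≠ j → V i ∩ V j ⊆ edgeCore Γ := by
    intro i j hij ω hω
    fin_cases i <;> fin_cases j
    · exact absurd rfl hij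
    · exact ⟨a, b, hab, hω.1, hω.2⟩
    · exact ⟨a, c, hac, hω.1, hω.2⟩
    · exact ⟨b, a, hab.symm, hω.1, hω.2⟩
    · exact absurd rfl hij
    · exact ⟨b, c, hbc, hω.1, hω.2⟩
    · exact ⟨c, a, hac.symm, hω.1, hω.2⟩
    · exact ⟨c, b, hbc.symm, hω.1, hω.2⟩
    · exact absurd rfl hij
  have key := hsafe 3 V hV hcap
  rw [Fin.prod_univ_three, hV0, hV1, hV2, prodBernoulli_real_setOf_mem, prodBernoulli_real_setOf_mem,
    prodBernoulli_real_setOf_mem, hpa, hpb, hpc] at key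
  -- upper bound for the core
  let F : Finset ι := univ.filter fun v => ¬ (v = a ∨ v = b ∨ v = c)
  have hsub : edgeCore Γ ⊆ ((pairEv a b ∪ pairEv a c) ∪ pairEv b c) ∪ {ω | ∃ i ∈ F, i ∈ ω} := by
    rintro ω ⟨u, v, huv, hu, hv⟩
    by_cases hu' : u = a ∨ u = b ∨ u = c
    · by_cases hv' : v = a ∨ v = b ∨ v = c
      · left
        rcases hu' with rfl | rfl | rfl <;> rcases hv' with rfl | rfl | rfl
        · exact absurd rfl huv.ne
        · exact Or.inl (Or.inl ⟨hu, hv⟩)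
        · exact Or.inl (Or.inr ⟨hu, hv⟩)
        · exact Or.inl (Or.inl ⟨hv, hu⟩)
        · exact absurd rfl huv.ne
        · exact Or.inr ⟨hu, hv⟩
        · exact Or.inl (Or.inr ⟨hv, hu⟩)
        · exact Or.inr ⟨hv, hu⟩
        · exact absurd rfl huv.ne
      · right
        exact ⟨v, Finset.mem_filter.2 ⟨Finset.mem_univ _, hv'⟩, hv⟩
    · right
      exact ⟨u, Finset.mem_filter.2 ⟨Finset.mem_univ _, hu'⟩, hu⟩
  have hnull : (prodBernoulli p).real {ω | ∃ i ∈ F, i ∈ ω} ≤ 0 := by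
    refine (prodBernoulli_real_exists_mem_le_sum p F).trans (le_of_eq ?_)
    refine Finset.sum_eq_zero fun v hv => ?_
    exact hp0 v (Finset.mem_filter.1 hv).2
  have hA : (prodBernoulli p).real (edgeCore Γ) ≤ 3 / 4096 := by
    calc (prodBernoulli p).real (edgeCore Γ)
        ≤ (prodBernoulli p).real ((((pairEv a b ∪ pairEv a c) ∪ pairEv b c) ∪ {ω | ∃ i ∈ F, i ∈ ω})) :=
          measureReal_mono hsub
      _ ≤ (prodBernoulli p).real ((pairEv a b ∪ pairEv a c) ∪ pairEv b c) +
            (prodBernoulli p).real {ω | ∃ i ∈ F, i ∈ ω} := measureReal_union_le _ _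
      _ ≤ ((prodBernoulli p).real (pairEv a b) + (prodBernoulli p).real (pairEv a c) +
            (prodBernoulli p).real (pairEv b c)) + 0 := by
          gcongr
          · exact (measureReal_union_le _ _).trans (by gcongr; exact measureReal_union_le _ _)
      _ = 3 / 4096 := by
          rw [real_pairEv p hab.ne, real_pairEv p hac.ne, real_pairEv p hbc.ne, hpa, hpb, hpc]
          norm_num
  have h0 : 0 ≤ (prodBernoulli p).real (edgeCore Γ) := measureReal_nonneg
  nlinarith [key, hA, h0]

/-- **CONJECTURE (typed): every triangle-free graph has an A-safe graph core.**  Exact-census support: all graphs on at most 8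
vertices (memo); with `not_aSafe_of_triangle` it reads "a graph core is A-safe iff the graph is triangle-free"
(`aSafe_iff_cliqueFree_of_triangleFreeSafe`).  An obligation of this programme, never used as a fact. [conjecture, this work] -/
@[conjecture] def TriangleFreeSafe : Prop :=
  ∀ (n : ℕ) (Γ : SimpleGraph (Fin n)), Γ.CliqueFree 3 → ∀ p : Fin n → unitInterval, Safe p (edgeCore Γ)

/-- Under `TriangleFreeSafe`: **a graph core is A-safe iff the graph is triangle-free** (the "only if" half is the theorem
`not_aSafe_of_triangle`). [this work] -/
theorem aSafe_iff_cliqueFree_of_triangleFreeSafe (hconj : TriangleFreeSafe) {n : ℕ} (Γ : SimpleGraph (Fin n)) :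
    (∀ p : Fin n → unitInterval, Safe p (edgeCore Γ)) ↔ Γ.CliqueFree 3 := by
  classical
  refine ⟨fun h => ?_, fun h => hconj n Γ h⟩
  by_contra hcl
  obtain ⟨t, ht⟩ := not_forall.1 hcl
  rw [not_not, SimpleGraph.is3Clique_iff] at ht
  obtain ⟨a, b, c, hab, hac, hbc, -⟩ := ht
  obtain ⟨p, hp⟩ := not_aSafe_of_triangle Γ hab hac hbc
  exact hp (h p)

end SafeCalc

end Summit.CriticalPhenomena.PercolationContinuityZ3.Theorems.SunflowerPartition
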